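import Literature.NumberTheory.Automorphic.UnboundedDenominatorsFields
import Literature.NumberTheory.Automorphic.GammaTwoModularFormsBasis
import Literature.NumberTheory.Automorphic.ModularLambdaWeightZero
import Literature.NumberTheory.ModularForms.QExpansionAlgebra
import HarnessLib

/-!
# The unbounded denominators theorem (Calegari–Dimitrov–Tang) — §4.2: `λ ∈ M_2`

PROOF-ONLY sequel (no definition, no named fact; D-0026) of the fields instalment
`UnboundedDenominatorsFields.lean` (`levelField N = M_N ⊗ ℂ` inside `Mer = Frac 𝓗`). Source:
F. Calegari, V. Dimitrov, Y. Tang, *The unbounded denominators conjecture*, J. Amer. Math. Soc. **38**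
(2025), 627–702 = arXiv:2109.09040, §4.2, Definition 4.2.1 and the sentence after it:
"For example, the holomorphic modular forms on `Y(2)` are given by `ℚ[λ^{±1}, (1 − λ)^{±1}]` and the
`ℚ(λ)`-vector space generated by such elements inside `ℚ((q^{1/N}))` is `M_2 = ℚ(λ)`."

## What is proved

* §1 The weight-`12` forms `U⁶` and `W U⁵` on `Γ(2)` (`U = θ₃⁴`, `V = θ₂⁴`, `W = θ₄⁴`; tree
  `JacobiThetaGammaTwo`, `GammaTwoModularFormsBasis`) have rational-integer `q₂`-expansions
  (`q₂ = e^{πiτ}`): `U⁶` by `exists_qExpansion_thetaU_pow_eq_map`, `W U⁵` because `W(τ) = U(τ + 1)`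
  has the expansion of `U` with alternating signs (`QExpansionAlgebra.qExpansion_vadd_one_coeff`).
* §2 ★ `exists_modularLambda_mem_levelField_two` — **the modular function `λ = V/U = 1 − W/U` lies in
  `M_2`** (as the element `1 − (W U⁵/Δ)/(U⁶/Δ)` of `Mer`, the two quotients being generators of
  `M_2`); hence `λ ∈ M_N ⊆ R_N` for every even `N` (`exists_modularLambda_mem_levelField`). This puts
  CDT's base field `ℚ(λ)` (here `ℂ(λ)`) inside the tree's `levelField 2`.

## References

* [CalegariDimitrovTang2025] F. Calegari, V. Dimitrov, Y. Tang, The unbounded denominators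
  conjecture, J. Amer. Math. Soc. 38 (2025), no. 3, 627–702; arXiv:2109.09040. §4.2
  (Definition 4.2.1, `M_2 = ℚ(λ)`).
-/

noncomputable section

namespace Literature.NumberTheory.Automorphic

open scoped MatrixGroups ModularForm Manifold
open UpperHalfPlane CongruenceSubgroup Matrix.SpecialLinearGroup ModularGroup
open Literature.NumberTheory.ModularForms Literature.NumberTheory.ModularForms.QExpansionAlgebra
open Literature.NumberTheory.EllipticCurves.JacobiThetaNull ModularLambda

namespace UnboundedDenominators

/-! ### §1. The forms `U⁶` and `W U⁵` on `Γ(2)` and their integral `q₂`-expansions -/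

/-- Products of power series with integer coefficients have integer coefficients. [folklore] -/
private theorem forall_coeff_int_mul' {φ ψ : PowerSeries ℂ}
    (hφ : ∀ n : ℕ, ∃ z : ℤ, PowerSeries.coeff n φ = (z : ℂ))
    (hψ : ∀ n : ℕ, ∃ z : ℤ, PowerSeries.coeff n ψ = (z : ℂ)) :
    ∀ n : ℕ, ∃ z : ℤ, PowerSeries.coeff n (φ * ψ) = (z : ℂ) := by
  choose a ha using hφ
  choose b hb using hψ
  have hΦ : φ = (PowerSeries.mk a).map (Int.castRingHom ℂ) := by
    ext n
    rw [PowerSeries.coeff_map, PowerSeries.coeff_mk, ha, eq_intCast]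
  have hΨ : ψ = (PowerSeries.mk b).map (Int.castRingHom ℂ) := by
    ext n
    rw [PowerSeries.coeff_map, PowerSeries.coeff_mk, hb, eq_intCast]
  intro n
  refine ⟨PowerSeries.coeff n (PowerSeries.mk a * PowerSeries.mk b), ?_⟩
  rw [hΦ, hΨ, ← map_mul, PowerSeries.coeff_map, eq_intCast]

/-- The monomial `Vʲ U^{6−j}` (`j ≤ 6`) is a weight-`12` modular form on `Γ(2)` (tree
`ModularLambda.monomial_slash`, `thetaV_slash_eq_of_mem_Gamma_two`, `thetaU_slash_of_mem_Gamma_two`,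
boundedness at all cusps from `slash_mem_six`). [folklore] -/
private theorem exists_monomial_form {j : ℕ} (hj : j ≤ 6) :
    ∃ F : ModularForm ((Gamma 2 : Subgroup SL(2, ℤ)) : Subgroup (GL (Fin 2) ℝ)) (12 * ((1 : ℕ) : ℤ)),
      (F : ℍ → ℂ) = thetaV ^ j * thetaU ^ (6 - j) := by
  have hVsix : thetaV ∈ ({thetaU, -thetaU, thetaV, -thetaV, thetaW, -thetaW} : Set (ℍ → ℂ)) := by
    simp
  have hUsix : thetaU ∈ ({thetaU, -thetaU, thetaV, -thetaV, thetaW, -thetaW} : Set (ℍ → ℂ)) := by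
    simp
  let φ : ModularForm ((Gamma 2 : Subgroup SL(2, ℤ)) : Subgroup (GL (Fin 2) ℝ)) (2 * (6 : ℕ) : ℤ) :=
    { toFun := thetaV ^ j * thetaU ^ (6 - j)
      slash_action_eq' := fun A hA ↦ by
        obtain ⟨γ, hγ, rfl⟩ := hA
        show (thetaV ^ j * thetaU ^ (6 - j)) ∣[(2 * (6 : ℕ) : ℤ)] γ = thetaV ^ j * thetaU ^ (6 - j)
        rw [monomial_slash hj, thetaV_slash_eq_of_mem_Gamma_two hγ,
          thetaU_slash_of_mem_Gamma_two hγ]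
      holo' := (mdifferentiable_thetaV.pow _).mul (mdifferentiable_thetaU.pow _)
      bdd_at_cusps' := fun hc ↦ by
        rw [Subgroup.IsArithmetic.isCusp_iff_isCusp_SL2Z] at hc
        rw [OnePoint.isBoundedAt_iff_forall_SL2Z hc]
        intro γ _
        rw [monomial_slash hj]
        exact (isBoundedAtImInfty_pow (isBoundedAtImInfty_of_mem_six (slash_mem_six γ _ hVsix))
          _).mul (isBoundedAtImInfty_pow (isBoundedAtImInfty_of_mem_six
            (slash_mem_six γ _ hUsix)) _) }
  exact ⟨φ.mcast (by norm_num), rfl⟩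

/-- `U = θ₃⁴` is nice of period `2` (periodic, holomorphic, bounded at `i∞`). [folklore] -/
private theorem nice_thetaU :
    Function.Periodic (thetaU ∘ ofComplex) (2 : ℝ) ∧ MDiff thetaU ∧ IsBoundedAtImInfty thetaU :=
  ⟨periodic_thetaU, mdifferentiable_thetaU, isBoundedAtImInfty_thetaU⟩

/-- `W = θ₄⁴ = U(· + 1)`. [folklore] -/
private theorem thetaW_eq_vadd : thetaW = fun τ : ℍ ↦ thetaU ((1 : ℝ) +ᵥ τ) := by
  funext τ
  rw [thetaU_vadd_one]

/-- **`U⁶` has a rational-integer `q₂`-expansion.** [folklore] -/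
private theorem forall_coeff_thetaU_pow (n : ℕ) :
    ∀ m : ℕ, ∃ z : ℤ, PowerSeries.coeff m (qExpansion (2 : ℝ) (fun τ : ℍ ↦ thetaU τ ^ n)) = (z : ℂ) := by
  obtain ⟨E, -, hE, -⟩ := exists_qExpansion_thetaU_pow_eq_map one_ne_zero n
  have h2 : ((2 * 1 : ℕ) : ℝ) = 2 := by norm_num
  rw [h2] at hE
  intro m
  exact ⟨PowerSeries.coeff m E, by rw [hE, PowerSeries.coeff_map, eq_intCast]⟩

/-- **`W` has a rational-integer `q₂`-expansion** (that of `U` with alternating signs, `W(τ) = U(τ+1)`,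
`q₂(τ + 1) = −q₂(τ)`). [folklore] -/
private theorem forall_coeff_thetaW :
    ∀ m : ℕ, ∃ z : ℤ, PowerSeries.coeff m (qExpansion (2 : ℝ) thetaW) = (z : ℂ) := by
  intro m
  obtain ⟨z, hz⟩ := forall_coeff_thetaU_pow 1 m
  have h1 : (fun τ : ℍ ↦ thetaU τ ^ 1) = thetaU := by funext τ; rw [pow_one]
  rw [h1] at hz
  rw [thetaW_eq_vadd, qExpansion_vadd_one_coeff two_pos nice_thetaU m, hz]
  -- `e^{2πi/2} = -1`
  have hexp : Complex.exp (2 * Real.pi * Complex.I / (2 : ℝ)) = -1 := by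
    rw [show (2 * Real.pi * Complex.I / (2 : ℝ) : ℂ) = Real.pi * Complex.I by push_cast; ring,
      Complex.exp_pi_mul_I]
  rw [hexp]
  exact ⟨(-1) ^ m * z, by push_cast; ring⟩

/-- **The forms `U⁶` and `W U⁵` on `Γ(2)` with integral `q₂`-expansions** — the data putting
`λ = 1 − W/U = 1 − (W U⁵/Δ)/(U⁶/Δ)` into `M_2`. [cite: CalegariDimitrovTang2025, §4.2 ("the
holomorphic modular forms on `Y(2)` are given by `ℚ[λ^{±1}, (1 − λ)^{±1}]`")] -/
theorem exists_thetaU_pow_six_and_thetaW_mul :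
    ∃ (B A : ModularForm ((Gamma 2 : Subgroup SL(2, ℤ)) : Subgroup (GL (Fin 2) ℝ)) (12 * ((1 : ℕ) : ℤ))),
      (B : ℍ → ℂ) = thetaU ^ 6 ∧ (A : ℍ → ℂ) = thetaW * thetaU ^ 5 ∧
      (∀ n : ℕ, ∃ z : ℤ, PowerSeries.coeff n (qExpansion (2 : ℝ) B) = (z : ℂ)) ∧
      (∀ n : ℕ, ∃ z : ℤ, PowerSeries.coeff n (qExpansion (2 : ℝ) A) = (z : ℂ)) := by
  obtain ⟨B, hB⟩ := exists_monomial_form (j := 0) (by norm_num)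
  obtain ⟨V5, hV5⟩ := exists_monomial_form (j := 1) (by norm_num)
  rw [pow_zero, one_mul] at hB
  rw [pow_one] at hV5
  -- `A := U⁶ − V U⁵ = W U⁵` (Jacobi: `U = V + W`)
  refine ⟨B, B - V5, hB, ?_, ?_, ?_⟩
  · rw [ModularForm.coe_sub, hB, hV5, thetaU_eq_thetaV_add_thetaW]
    ring
  · intro n
    have hfun : (B : ℍ → ℂ) = fun τ : ℍ ↦ thetaU τ ^ 6 := by rw [hB]; funext τ; rfl
    rw [hfun]
    exact forall_coeff_thetaU_pow 6 n
  · have hfun : ((B - V5 : ModularForm _ _) : ℍ → ℂ) = thetaW * thetaU ^ 5 := by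
      rw [ModularForm.coe_sub, hB, hV5, thetaU_eq_thetaV_add_thetaW]
      ring
    rw [hfun, qExpansion_mul_of_nice two_pos (thetaW_eq_vadd ▸ nice_vadd_one nice_thetaU)
      (nice_pow nice_thetaU 5)]
    have h5 : (thetaU ^ 5 : ℍ → ℂ) = fun τ : ℍ ↦ thetaU τ ^ 5 := by funext τ; rfl
    rw [h5]
    exact forall_coeff_int_mul' forall_coeff_thetaW (forall_coeff_thetaU_pow 5)

/-! ### §2. `λ ∈ M_2` -/

/-- ★ **`λ ∈ M_2`** [cite: CalegariDimitrovTang2025, §4.2 (`M_2 = ℚ(λ)`)]: the modular function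
`λ = θ₂⁴/θ₃⁴` (as the holomorphic function `τ ↦ λ(τ)` on `ℍ`, an element of `𝓗`) lies in
`levelField 2`: `λ = 1 − W/U = 1 − (W U⁵/Δ)/(U⁶/Δ)` with both quotients generators of `M_2`. -/
theorem exists_modularLambda_mem_levelField_two :
    ∃ L : hol, (L : ℍ → ℂ) = (fun τ : ℍ ↦ modularLambda τ) ∧ algebraMap hol Mer L ∈ levelField 2 := by
  obtain ⟨B, A, hB, hA, hBint, hAint⟩ := exists_thetaU_pow_six_and_thetaW_mul
  have hmdiff : MDiff fun τ : ℍ ↦ modularLambda τ :=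
    ModularLambda.mdifferentiable_of_differentiableAt fun z hz ↦ differentiableAt_modularLambda hz
  let L : hol := ⟨fun τ : ℍ ↦ modularLambda τ, (mem_hol).mpr hmdiff⟩
  refine ⟨L, rfl, ?_⟩
  haveI : NeZero (2 : ℕ) := ⟨two_ne_zero⟩
  have hBmem : algebraMap hol Mer (modFun 1 B) ∈ levelField 2 :=
    IntermediateField.subset_adjoin ℂ _
      (show algebraMap hol Mer (modFun 1 B) ∈ levelGens 2 from
        ⟨Gamma 2, inferInstance, 1, B, le_rfl, by exact_mod_cast hBint, rfl⟩)
  have hAmem : algebraMap hol Mer (modFun 1 A) ∈ levelField 2 :=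
    IntermediateField.subset_adjoin ℂ _
      (show algebraMap hol Mer (modFun 1 A) ∈ levelGens 2 from
        ⟨Gamma 2, inferInstance, 1, A, le_rfl, by exact_mod_cast hAint, rfl⟩)
  -- `U⁶/Δ ≠ 0`
  have hB0 : algebraMap hol Mer (modFun 1 B) ≠ 0 := by
    rw [map_ne_zero_iff _ algebraMap_hol_injective]
    intro h0
    have := congrArg (fun f : hol ↦ (f : ℍ → ℂ) UpperHalfPlane.I) h0
    simp only [modFun_apply, hB, Pi.pow_apply, Subalgebra.coe_zero, Pi.zero_apply, div_eq_zero_iff,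
      pow_eq_zero_iff', thetaU_ne_zero, ModularForm.discriminant_ne_zero, ne_eq, false_and,
      or_self] at this
  -- `U⁶/Δ · (1 − λ) = W U⁵/Δ` in `𝓗`
  have hmul : algebraMap hol Mer (modFun 1 B) * (1 - algebraMap hol Mer L) =
      algebraMap hol Mer (modFun 1 A) := by
    rw [← map_one (algebraMap hol Mer), ← map_sub, ← map_mul]
    congr 1
    apply Subtype.ext
    funext τ
    have hU : thetaU τ ≠ 0 := thetaU_ne_zero τ
    have hΔ : ModularForm.discriminant τ ≠ 0 := ModularForm.discriminant_ne_zero τ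
    simp only [L, Subalgebra.coe_mul, Subalgebra.coe_sub, Subalgebra.coe_one, Pi.mul_apply,
      Pi.sub_apply, Pi.one_apply, modFun_apply, hA, hB, Pi.pow_apply,
      one_sub_modularLambda τ.im_pos, thetaW_apply, thetaU_apply]
    field_simp
  have hdiv : 1 - algebraMap hol Mer L =
      algebraMap hol Mer (modFun 1 A) / algebraMap hol Mer (modFun 1 B) := by
    rw [eq_div_iff hB0, mul_comm]
    exact hmul
  rw [show algebraMap hol Mer L = 1 - (1 - algebraMap hol Mer L) by ring, hdiv]
  exact sub_mem (one_mem _) (div_mem hAmem hBmem)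

/-- **`λ ∈ M_N ⊆ R_N` for every even `N > 0`.** [cite: CalegariDimitrovTang2025, §4.2 and
Lemma 4.2.3 ("injective algebra maps `M_2 → M_N → R_N`")] -/
theorem exists_modularLambda_mem_levelField {N : ℕ} (hN : 0 < N) (heven : Even N) :
    ∃ L : hol, (L : ℍ → ℂ) = (fun τ : ℍ ↦ modularLambda τ) ∧
      algebraMap hol Mer L ∈ levelField N ∧ algebraMap hol Mer L ∈ bddDenField N := by
  obtain ⟨L, hL, hmem⟩ := exists_modularLambda_mem_levelField_two
  have h2 : levelField 2 ≤ levelField N := levelField_mono two_pos heven.two_dvd hN.ne'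
  exact ⟨L, hL, h2 hmem, levelField_le_bddDenField N (h2 hmem)⟩

end UnboundedDenominators

end Literature.NumberTheory.Automorphic

end
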